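import Mathlib.Tactic.Linarith
import Mathlib.Tactic.NormNum
import Mathlib.Tactic.Ring
import Mathlib.Tactic.IntervalCases
import HarnessLib

/-!
# The (0,1) cell of the ι-window, XLIII: the product ground `B₁ × B₂`, XXX — THE CORNER XV (report [XLIII] `H2-ZERO-ONE-43.md`):
# arithmetic shadow of THEOREM QUADRATIC t-GROWTH (the t̄-part of a balanced thick line is Fibonacci-superadditive),
# its global form (superadditivity of the t̄-excess when `Ψ₁ ≡ 0`), COROLLARY PROFILE-EXCLUDED, the frame invariance of `Δ₂`,
# and the independence of the computed law N2 from the theorem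

Family `hodge`, b2b cell `hweil` (helper of item stmt-HodgeConjecture-2524). Report
`run/shared/lean/b2b/hodge-weil/b2b-hweil-pv1-g55/H2-ZERO-ONE-43.md` ([XLIII]). Context (the report's words, nothing of them formalised here): for a
BALANCED thick two-block S-line `Y` (`π_*𝒪_Y = 𝒪_{bΘ}[t̄]`, `t̄² = Ψt̄ + Φ`) the x̃-layers at a point `p` have 1-part pole orders `k′_j`, t̄-part pole
orders `k″_j`, hidden 1-layer pole orders `k̃′_j ≥ k′_j`; `a` is the pole order of `Φ₂` at `p` in a `Ψ₁`-free frame. The report proves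
`E_i · Q̃_{i+1} ⊂ E_{2i+1}` (LEMMA E·Q̃, from the square of a t̄-led element), combines it with HIDDEN-TRANSFER `Φ₂E_{i−1} ⊂ Q̃_{i+1}` of [XLII] to get
`k″_{2i+1} ≥ k″_i + k″_{i−1} + a` (THEOREM QUADRATIC t-GROWTH), sums over the points of `Γ` (`Σ_p a(p) = 4`) to get `ℓ″_{2i+1} ≥ ℓ″_i + ℓ″_{i−1}`
when `Ψ₁ ≡ 0`, and concludes that the profile of [XLI] PROPOSITION PROFILE (flat 1-part, t̄-excess `≡ 10 + κ`) is not the layer profile of any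
balanced thick line. The theorems below are the integer arithmetic of those statements and two ring identities. They claim no geometry.
HONEST FRAMING: census work inside the ladder's H2 test ((0,1) cell) on the SPECIAL fourfold `X₀`; nothing here is a rung; no case of the Hodge
conjecture is proved; no statement of [Markman 2025] / [Perry 2026] / [EdGFS 2025] is used.
-/

-- mandated namespace `Summit.HodgeConjecture.HodgeConjecture.…` (Problem = Summit) trips `linter.dupNamespace`; the lakefile disables it
-- tree-wide (weak option), restated here so stand-alone elaboration is warning-free too.
set_option linter.dupNamespace false

namespace Summit.HodgeConjecture.HodgeConjecture.WeilTypeLadder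

section ProductGroundThirty

/-- **[XLIII] 2.1–2.2 (LEMMA E·Q̃ and THEOREM QUADRATIC t-GROWTH, the bookkeeping).** (a) LEMMA E·Q̃ gives `k″_{2i+1} ≥ k″_i + k̃′_{i+1}` (the
square of the t̄-led generator of `E_i` is t̄-led at order `2i+1` with coefficient `2rσ`, `r` the hidden 1-coefficient); HIDDEN-TRANSFER ([XLII]
3.1 (d)) gives `k̃′_{i+1} ≥ k″_{i−1} + a`; hence `k″_{2i+1} ≥ k″_i + k″_{i−1} + a`. (b) The alternative AM–GM route: the three t̄-leads `A = 2rσ`,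
`B = rr′ + Φ₂σσ′`, `C = 2Φ₂σ′r′` lie in `E_{2i+1}`; if `B` cancels then `pole(rr′) = pole(Φ₂σσ′) = T` and `pole A + pole C = 2T`, so one of them is
`≥ T`. [`le_trans`; `omega`] -/
theorem pg30_quadratic_growth :
    (∀ k2i k2im1 k2odd kh a : ℤ, k2odd ≥ k2i + kh → kh ≥ k2im1 + a → k2odd ≥ k2i + k2im1 + a) ∧
    (∀ pA pC T : ℤ, pA + pC = 2 * T → max pA pC ≥ T) ∧
    (∀ pA pB pC T k : ℤ, (pB ≥ T ∨ pA + pC = 2 * T) → k ≥ pA → k ≥ pB → k ≥ pC → k ≥ T) := by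
  refine ⟨fun k2i k2im1 k2odd kh a h1 h2 => by linarith, fun pA pC T h => ?_, fun pA pB pC T k h hA hB hC => ?_⟩
  · rcases le_total pA pC with hle | hle
    · rw [max_eq_right hle]; omega
    · rw [max_eq_left hle]; omega
  · rcases h with h | h <;> omega

/-- **[XLIII] 2.4 (COROLLARY t̄-EXCESS SUPERADDITIVITY, global form).** With `d″_j = ℓ″_j + 2j` and the pointwise theorem summed over the points of
`Γ` (all with `π = 0` when `Ψ₁ ≡ 0`; `Σ_p a(p) = 4`): `d″_{2i+1} ≥ d″_i + d″_{i−1} + 4` is `ℓ″_{2i+1} ≥ ℓ″_i + ℓ″_{i−1}`; and a linear profile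
`ℓ″_j = αj + β` satisfies it for all `i ≥ 1` iff `β ≤ 2α` (the t̄-excess may be linear, but its intercept is at most twice its slope).
[`linarith`; `constructor`/`nlinarith`-free: instantiate at `i = 1`] -/
theorem pg30_texcess_superadditive :
    (∀ l2odd l2i l2im1 i : ℤ,
        (l2odd + 2 * (2 * i + 1)) ≥ (l2i + 2 * i) + (l2im1 + 2 * (i - 1)) + 4 → l2odd ≥ l2i + l2im1) ∧
    (∀ α β : ℤ, (∀ i : ℤ, 1 ≤ i → α * (2 * i + 1) + β ≥ (α * i + β) + (α * (i - 1) + β)) ↔ β ≤ 2 * α) := by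
  refine ⟨fun l2odd l2i l2im1 i h => by linarith, fun α β => ⟨fun h => ?_, fun h i _ => by linarith⟩⟩
  have h1 := h 1 le_rfl
  linarith

/-- **[XLIII] 3.1 (COROLLARY PROFILE-EXCLUDED).** (a) The profile of [XLI] 5.1 has `ℓ″_j = 10 + κ` for `2 ≤ j ≤ b − 3`; at `i = 3` (layers
`2, 3, 7 ≤ b − 3`, i.e. `b ≥ 10`) the superadditivity `ℓ″_7 ≥ ℓ″_3 + ℓ″_2` reads `10 + κ ≥ 20 + 2κ`, false for every `κ ≥ 0`. (b) Pointwise: the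
profile's divisors are `D′_j = jG`, `D″_j = jG + H` (`2 ≤ j ≤ b − 3`), so at a point of multiplicity `m` in `G` and `c` in `H` (`a = 2m`):
`k″_7 ≥ k″_3 + k″_2 + a` reads `7m + c ≥ (3m + c) + (2m + c) + 2m`, i.e. `c ≤ 0`; hence `H = 0`, contradicting `deg H = 10 + κ ≥ 10`.
(c) More generally a t̄-excess constant `= C` on `[2, 7]` forces `C ≤ 0`. [`omega`/`linarith`] -/
theorem pg30_profile_excluded :
    (∀ κ : ℤ, 0 ≤ κ → ¬ ((10 + κ) ≥ (10 + κ) + (10 + κ))) ∧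
    (∀ m c : ℤ, 7 * m + c ≥ (3 * m + c) + (2 * m + c) + 2 * m → c ≤ 0) ∧
    (∀ κ degH : ℤ, degH = 10 + κ → 0 ≤ κ → degH ≤ 0 → False) ∧
    (∀ C : ℤ, C ≥ C + C → C ≤ 0) := by
  refine ⟨fun κ hκ h => by linarith, fun m c h => by linarith, fun κ degH h1 h2 h3 => by linarith, fun C h => by linarith⟩

/-- **[XLIII] 4.1 (LEMMA FRAME: `Δ₂` is shift-invariant; the precision point on `a(p)`).** Under the change of frame `t′ = t̄ − c` one has
`Ψ′ = Ψ − 2c`, `Φ′ = Φ + cΨ − c²` ([XLII] 2.0), and the discriminant is invariant: `Ψ′² + 4Φ′ = Ψ² + 4Φ` — so at a point with `π = 0` the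
quantity `a(p)` of the local lemmas must be read as `−ord_p(Ψ₁² + 4Φ₂)` (the value of `−ord Φ₂` in any `Ψ₁`-free frame), which differs from the
global frame's `−ord_p Φ₂` exactly when `Φ₂(p)` and `Ψ₁(p)²/4` cancel or when `Φ₂` is regular and `Ψ₁(p) ≠ 0`. Second identity: in a `Ψ₁`-free
frame the new `Φ₂` is `Φ₂ + Ψ₁²/4 = (Ψ₁² + 4Φ₂)/4`. [`ring`] -/
theorem pg30_frame_invariance :
    (∀ Ψ Φ c : ℚ, (Ψ - 2 * c) ^ 2 + 4 * (Φ + c * Ψ - c ^ 2) = Ψ ^ 2 + 4 * Φ) ∧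
    (∀ Ψ1 Φ2 : ℚ, Φ2 + (Ψ1 / 2) * Ψ1 - (Ψ1 / 2) ^ 2 = (Ψ1 ^ 2 + 4 * Φ2) / 4) := by
  refine ⟨fun Ψ Φ c => by ring, fun Ψ1 Φ2 => by ring⟩

/-- **[XLIII] 2.3 (the AM–GM identity behind route (b)) and 4.3 (LINK-2 erratum arithmetic).** (a) For the quadratic form
`q((s,r),(s′,r′)) = rs′ + r′s` on leading data: `q(v,w)² − q(v,v)·q(w,w) = (r s′ − r′ s)²` — the three t̄-leads of `β²`, `ββ′`, `β′²` are tied by a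
perfect square. (b) [XLI] 5.3 (a) printed `k″_2 = max(a, h)` at `π = 0`; the correct value is `max(a⁺, h − a⁺)` (`E_2 = O + OΦ₂ + u^{a⁺}Ψ₂O`), which is
`≤ max(a, h)` always and `< max(a, h)` iff `0 < a < h` — e.g. `(a, h) = (2, 5)` gives `3`, not `5` (engine-confirmed). [`ring`; `omega`] -/
theorem pg30_amgm_identity_and_link2 :
    (∀ r s r' s' : ℚ, (r * s' + r' * s) ^ 2 - (2 * r * s) * (2 * r' * s') = (r * s' - r' * s) ^ 2) ∧
    (∀ a h : ℤ, 0 ≤ h → max (max a 0) (h - max a 0) ≤ max a h) ∧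
    (∀ a h : ℤ, 0 < a → a < h → max (max a 0) (h - max a 0) < max a h) ∧
    (max (max (2 : ℤ) 0) (5 - max (2 : ℤ) 0) = 3 ∧ max (2 : ℤ) 5 = 5) := by
  refine ⟨fun r s r' s' => by ring, fun a h hh => ?_, fun a h ha hah => ?_, by decide⟩
  · rcases le_total a 0 with ha | ha
    · rw [max_eq_right ha, sub_zero, max_eq_right hh, max_eq_right (le_trans ha hh)]
    · rw [max_eq_left ha]
      rcases le_total a h with h1 | h1
      · rw [max_eq_right h1]; exact max_le h1 (by omega)
      · rw [max_eq_left h1]; exact max_le le_rfl (by omega)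
  · have ha0 : max a 0 = a := max_eq_left (le_of_lt ha)
    rw [ha0, max_eq_right (le_of_lt hah)]
    exact max_lt hah (by omega)

/-- **[XLIII] 2.6 (the computed law N2 is NOT an arithmetic consequence of the theorem).** The integer sequence `k = (0,0,5,5,5,5,5,10,10,…,10,15,…)`
(value `0` below `2`, `5` on `[2,6]`, `10` on `[7,14]`, `15` from `15` on) with `a = 0` is non-decreasing, satisfies GROWTH `k_{j+2} ≥ k_j + a`
and the theorem `k_{2i+1} ≥ k_i + k_{i−1} + a` for all `i ≤ 7`, yet violates N2 at `(i, j) = (2, 2)`: `k_6 = 5 < k_2 + k_2 + a = 10`. So N2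
(`k″_{i+j+2} ≥ k″_i + k″_j + a`, 0 violations in 14 400 engine instances) carries information beyond the theorem. [`decide` on the fifteen
instances, written out] -/
theorem pg30_N2_independent :
    let k : ℕ → ℤ := fun n => if n < 2 then 0 else if n < 7 then 5 else if n < 15 then 10 else 15
    (∀ n : ℕ, n ≤ 14 → k n ≤ k (n + 1)) ∧
    (∀ n : ℕ, n ≤ 13 → k (n + 2) ≥ k n + 0) ∧
    (∀ i : ℕ, 1 ≤ i → i ≤ 7 → k (2 * i + 1) ≥ k i + k (i - 1) + 0) ∧
    ¬ (k 6 ≥ k 2 + k 2 + 0) := by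
  refine ⟨?_, ?_, ?_, by decide⟩
  · intro n hn
    interval_cases n <;> decide
  · intro n hn
    interval_cases n <;> decide
  · intro i hi1 hi2
    interval_cases i <;> decide

end ProductGroundThirty

end Summit.HodgeConjecture.HodgeConjecture.WeilTypeLadder
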